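import Summits.BirchSwinnertonDyer.BirchSwinnertonDyer.Theses.ThetaPartnerAtTwo
import Summits.BirchSwinnertonDyer.BirchSwinnertonDyer.Theorems.ByReductionTypeAtTwoSupersingularColemanRoadV5
import HarnessLib

/-!
# Route `ThetaPartnerAtTwo` (TP2), crux K3 `SignedKatoDivisibilityUpToAtTwo` (item stmt-BirchSwinnertonDyer-20308):
# K3 BY NAME from the two Kato PUB facts and the RATIONAL Coleman–Kato package at `2` — i.e. from route
# `ByReductionTypeAtTwo`'s stubs (1′) `stub_katoPub` and (4) `stub_zeroColemanKato` of crux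
# `SupersingularRankZeroAtTwo` (item 19097, line `signed_halves_two` v8), the guarded `𝔭 ∋ 2` clause of (4)
# NOT used — cross-route memo CROSS-ROUTE-TP2-K3K4-v1 §2 / cell ruling RC-138 (2), helper H3
# (seat `bsd-2adic-ss-1x`, the WIDTH-LEVER second prover lane on 19097)

HONEST FRAMING (cells `bsd-2adic` run/shared/lean/pub/bsd-2adic/ and `bsd-wall` …/bsd-wall/bsd-wall-p2/, HUMAN
RULINGS D-0036/D-0054/D-0074): THEOREMS ONLY — no definition, no named fact, no instance, no `sorry`; nothing about
any Selmer group or zeta element is asserted beyond the displayed binders; closes no item by itself; BSD is NOT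
proved by any of this. PARTITION (D-0054): X5@2 good-SUPERSINGULAR, `a₂ = 0` sub-row (208 rank-`0` census
classes; TP2's theta habitat = 19 of them) × `p = 2` — types-the-object-of (K3 20308 ⟸ 19097's registered stubs
(1′) + (4)); bears_on: TP2 K3 (20308) · K4-leaf crux 19097.

## What is proved

* `exists_charGenerator_mul_eq_C_pow_mul_of_colemanSkeletonRat` — HELPER H3 at ANY prime `p` and either
  sign `ε`, pure module theory over `Λ = ℤ_p⟦T⟧` on the RATIONAL Coleman skeleton of Kobayashi §7 / Kato §17:
  `𝐇¹ = I.H` torsion free of rank `≤ 1`, `X⁰ = Y.X` torsion, `X^ε = D.X`, `𝐇¹ →loc P →toX X^ε →δ X⁰` exact at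
  `P` and at `X^ε`, `col : P ↪ Λ`, `G ∈ col(loc Z)` with `ι G = F`, and the Euler-system length bound
  `length_𝔭 X⁰ ≤ length_𝔭 (𝐇¹/Z)` ONLY at the height-one primes `𝔭 ∌ p` (Kato Thm. 12.5 (3): no image
  hypothesis, no parity of `p`) ⟹ `char X^ε = (g)` and **`ι(g · h) = p^m · F`** for some `h ∈ Λ`, `m ≥ 0` —
  Kobayashi's Thm. 4.1 FIRST DISPLAY («`pⁿ L_p(E, α, X) ∈ Char X`») through the tree's
  `SSColemanRoad.exists_pow_mul_mem_charIdeal_of_colemanSkeletonRat` (+ `charIdeal_isPrincipal_holds`; the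
  degenerate `G = 0` gives `h = 0`).
* `signedKatoDivisibilityUpToAtTwo_of_colemanKatoRatAtTwo` — **K3 BY NAME** from `Kato2004.thm12_4` (12.4 (2):
  `𝐇¹_Γ(T₂E)` torsion free of rank `1`, PRINT any `p`), `Kato2004_fineSelmerDual_isTorsion` (12.4 (1) ∘ (17.13.1),
  PRINT any `p`) and the ∀-closed RATIONAL package at `2` on the `a₂ = 0` sub-row: for every cyclotomic datum
  matching the variable, newform `f`, period ratio `ϖ`, Pollack pair at `2` and dual datum `D` of `Sel⁺(E/ℚ_∞)`,
  pinned `I, Y, P ≤ Λ, loc, toX, δ, Z ≤ 𝐇¹, G` with F1 (7.21)@2 exactness · F3a `G ∈ Col⁺(loc Z)` · F3b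
  `ι G = ϖ · ι L♭` · F4rat (Kato 12.5 (3) at the `𝔭 ∌ 2`). This hypothesis is 19097's stub (4)
  `stub_zeroColemanKato` with its LAST (guarded, `TwoAdicSurjective W → F4 at 𝔭 ∋ 2`) clause DELETED. The
  continuity binder `[ContinuousSMul ℤ_[2] (T₂E)]` is discharged by the tree theorem
  `TateModule.continuousSMul_padicInt`.
* `signedKatoDivisibilityUpToAtTwo_of_zeroColemanKato` — the same with `hKato` = stub (1′) `stub_katoPub`
  VERBATIM and `hCK` = stub (4) `stub_zeroColemanKato` VERBATIM (v8 registered signatures): **TP2's K3 is the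
  first rung of 19097's stub (4)** — the integral refinement (`m = 0` under (12.5.2), Kurihara–Otsuki p. 564)
  and the `μ⁺ = 0` stub (4′) are what 19097 needs BEYOND K3, and exactly what TP2 replaces by CM-partner
  transport (memo §2–§3).

References: [Kobayashi2003] S. Kobayashi, Invent. Math. 152 (2003) 1–36, Thm. 4.1 (p. 8), Thm. 6.2–6.3 (p. 11),
Prop. 7.1, Cor. 7.2, Thm. 7.3 (pp. 12–13); [Kato2004Asterisque] K. Kato, Astérisque 295 (2004), Thm. 12.4 (1)(2)
(p. 221), Thm. 12.5 (3) (p. 222), Thm. 17.4 (p. 273), §17.13; [KuriharaOtsuki2006] pp. 557, 564; [Sprung2012]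
§§2–6 (Coleman maps at `p = 2`); cross-route memo run/shared/lean/pub/bsd-wall/bsd-wall-p2/xroute/CROSS-ROUTE-TP2-K3K4-v1.md
(sha16 a5ea7e9a17324178); cell ruling RC-138 (bsd-2adic STATUS 2026-08-27T10:47:20Z).
-/

set_option autoImplicit false
-- the Theorems namespace of this sub repeats the summit name by design (D-0017 nested layout)
set_option linter.dupNamespace false

noncomputable section

open scoped Classical MatrixGroups ModularForm

open CongruenceSubgroup WeierstrassCurve Literature.NumberTheory.EllipticCurves
  Literature.NumberTheory.EllipticCurves.ModularForms Literature.NumberTheory.EllipticCurves.Sprung2017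
  Literature.NumberTheory.EllipticCurves.Rank1Residual Literature.NumberTheory.EllipticCurves.Rank1Residual.Typed
  Literature.NumberTheory.EllipticCurves.Kobayashi2003 Literature.NumberTheory.EllipticCurves.IwasawaDual
  ZpExtension Summit.BirchSwinnertonDyer.Rank1Residual Summit.BirchSwinnertonDyer.Rank1Residual.Supersingular
  Summit.BirchSwinnertonDyer.Rank1Residual.X5.O1 Summit.BirchSwinnertonDyer.BirchSwinnertonDyer.Theses.ThetaPartnerAtTwo

namespace Summit.BirchSwinnertonDyer.BirchSwinnertonDyer.Theorems

namespace ThetaPartnerXRoute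

/-! ## §1 Helper H3: Kobayashi's Thm. 4.1 first display from the RATIONAL Coleman skeleton (any `p`, any sign) -/

section AnyPrime

variable {p : ℕ} [Fact p.Prime] {W : WeierstrassCurve ℚ} [W.IsElliptic]
  [ContinuousSMul ℤ_[p] (W.tateModule p)]
  {κ : ZpExtension ℚ p} {γ : Field.absoluteGaloisGroup ℚ} {ε : ℤˣ}
  {P : Type*} [AddCommGroup P] [Module (IwasawaAlgebra p) P]

/-- **H3 — `char X^ε = (g)` and `ι(g·h) = p^m · F` from the RATIONAL Coleman skeleton (any prime `p`, either
sign; no image hypothesis).** On the pinned `𝐇¹ = I.H` (torsion free of rank `≤ 1`), `X⁰ = Y.X` (torsion) and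
`X^ε = D.X`: if `𝐇¹ →loc P →toX X^ε →δ X⁰` is exact at `P` and at `X^ε`, `col : P ↪ Λ` is injective,
`G ∈ col(loc Z)` has `ι G = F` in `ℚ_p⟦T⟧`, and `length_𝔭 X⁰ ≤ length_𝔭 (𝐇¹/Z)` at every height-one `𝔭 ∌ p`
(Kato Thm. 12.5 (3)), then for the characteristic power series `g` of `X^ε` (`Λ` a UFD:
`charIdeal_isPrincipal_holds`) there are `h ∈ Λ`, `m ≥ 0` with `ι(g·h) = p^m · F` — Kobayashi's Thm. 4.1,
FIRST display, read as module theory (`SSColemanRoad.exists_pow_mul_mem_charIdeal_of_colemanSkeletonRat`;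
`G = 0` is the degenerate case `h = 0`). [cite: Kobayashi2003, Thm. 4.1 first display (p. 8) and Thm. 7.3 (p. 13)]
[cite: Kato2004Asterisque, Thm. 12.5 (3) (p. 222) and Thm. 17.4 (2) (p. 273)] -/
theorem exists_charGenerator_mul_eq_C_pow_mul_of_colemanSkeletonRat (hγ : κ.IsTopGenerator γ)
    (I : Kato2004.IwasawaH1Data W p κ γ) [Module.IsTorsionFree (IwasawaAlgebra p) I.H]
    (hrank : Module.rank (IwasawaAlgebra p) I.H ≤ 1)
    (Y : W.FineSelmerDualData κ γ) (D : SignedSelmerDualData W κ γ ε)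
    (loc : I.H →ₗ[IwasawaAlgebra p] P) (col : P →ₗ[IwasawaAlgebra p] IwasawaAlgebra p)
    (hcol : Function.Injective col)
    (toX : P →ₗ[IwasawaAlgebra p] D.X) (δ : D.X →ₗ[IwasawaAlgebra p] Y.X)
    (hPX : Function.Exact loc toX) (hXY : Function.Exact toX δ)
    (hY : Module.IsTorsion (IwasawaAlgebra p) Y.X)
    (Z : Submodule (IwasawaAlgebra p) I.H) {G : IwasawaAlgebra p}
    (hGZ : G ∈ Submodule.map (col ∘ₗ loc) Z)
    (hES : ∀ 𝔭 : PrimeSpectrum (IwasawaAlgebra p), 𝔭.asIdeal.height = 1 →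
      PowerSeries.C (p : ℤ_[p]) ∉ 𝔭.asIdeal →
      Literature.NumberTheory.EllipticCurves.Module.lengthAt (IwasawaAlgebra p) Y.X 𝔭 ≤
        Literature.NumberTheory.EllipticCurves.Module.lengthAt (IwasawaAlgebra p) (I.H ⧸ Z) 𝔭)
    {F : PowerSeries ℚ_[p]} (hιG : iwasawaToPowerSeries p G = F) :
    ∃ (g h : IwasawaAlgebra p) (m : ℕ), D.charIdeal = Ideal.span {g} ∧
      iwasawaToPowerSeries p (g * h) = PowerSeries.C ((p : ℚ_[p]) ^ m) * F := by
  obtain ⟨g, hg⟩ := (charIdeal_isPrincipal_holds p D.X).principal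
  have hg' : D.charIdeal = Ideal.span {g} := hg
  by_cases hG : G = 0
  · refine ⟨g, 0, 0, hg', ?_⟩
    rw [← hιG, hG, mul_zero, map_zero, mul_zero]
  · obtain ⟨-, m, hm⟩ := SSColemanRoad.exists_pow_mul_mem_charIdeal_of_colemanSkeletonRat hγ I hrank Y D
      loc col hcol toX δ hPX hXY hY Z hG hGZ hES
    rw [hg'] at hm
    obtain ⟨h, hh⟩ := Ideal.mem_span_singleton'.mp hm
    refine ⟨g, h, m, hg', ?_⟩
    have hCp : iwasawaToPowerSeries p (PowerSeries.C (p : ℤ_[p])) = PowerSeries.C (p : ℚ_[p]) := by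
      rw [PowerSeries.map_C, map_natCast]
    rw [mul_comm, hh, map_mul, map_pow, hCp, hιG, ← map_pow]

end AnyPrime

/-! ## §2 K3 `SignedKatoDivisibilityUpToAtTwo` BY NAME from Kato PUB + the rational package at `2` -/

/-- **K3 (item 20308) from `Kato2004.thm12_4`, `Kato2004_fineSelmerDual_isTorsion` and the ∀-closed RATIONAL
Coleman–Kato package at `2` on the `a₂ = 0` sub-row** (= 19097's stub (4) `stub_zeroColemanKato` with its last,
guarded `𝔭 ∋ 2` clause deleted): at each datum, H3 with `F = ϖ · ι L♭` gives `char X⁺ = (g)`,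
`ι(g·h) = 2^m · ϖ · ι L♭` — which is K3's conclusion (`kobayashiL 1 L⁺ L⁻ = L♭`). `𝐇¹` torsion free of rank
`≤ 1` is 12.4 (2) (`h124`), `X⁰` torsion is 12.4 (1) ∘ (17.13.1) (`hX0`), the continuity of the Galois action
on `T₂E` is the tree theorem `TateModule.continuousSMul_padicInt`. No `TwoAdicSurjective`, no `μ`.
[cite: Kobayashi2003, Thm. 4.1 first display (p. 8), Thm. 6.3 (p. 11), Thm. 7.3 (p. 13)]
[cite: Kato2004Asterisque, Thm. 12.4 (1)(2) (p. 221) and Thm. 12.5 (3) (p. 222)] [cite: KuriharaOtsuki2006, p. 564] -/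
theorem signedKatoDivisibilityUpToAtTwo_of_colemanKatoRatAtTwo (h124 : Kato2004.thm12_4)
    (hX0 : Kato2004_fineSelmerDual_isTorsion)
    (hCK : ∀ (W : WeierstrassCurve ℚ) [W.IsElliptic] [W.IsGloballyMinimal],
      ¬ W.HasCM → W.analyticRank = 0 → GoodSS W 2 → W.frobeniusTrace 2 = 0 →
      ∀ (κ : ZpExtension ℚ 2) (γ : Field.absoluteGaloisGroup ℚ),
        κ.IsCyclotomic → κ.IsTopGenerator γ → IsCyclotomicVariable 2 γ →
        ∀ [NeZero (W.conductorNorm ℤ)] (f : CuspForm (Gamma0 (W.conductorNorm ℤ)) 2),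
          IsNewformOf W f → ∀ (ϖ : ℚ), (ϖ : ℝ) * W.realPeriodRat = plusPeriod f →
        ∀ (Lplus Lminus : IwasawaAlgebra 2), IsPollackPair f 2 Lplus Lminus →
        ∀ (D : SignedSelmerDualData W κ γ 1) [ContinuousSMul ℤ_[2] (W.tateModule 2)],
          ∃ (I : Kato2004.IwasawaH1Data W 2 κ γ) (Y : W.FineSelmerDualData κ γ)
            (P : Submodule (IwasawaAlgebra 2) (IwasawaAlgebra 2))
            (loc : I.H →ₗ[IwasawaAlgebra 2] P) (toX : P →ₗ[IwasawaAlgebra 2] D.X)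
            (δ : D.X →ₗ[IwasawaAlgebra 2] Y.X) (Z : Submodule (IwasawaAlgebra 2) I.H)
            (G : IwasawaAlgebra 2),
            Function.Exact loc toX ∧ Function.Exact toX δ ∧
            G ∈ Submodule.map (P.subtype ∘ₗ loc) Z ∧
            iwasawaToPowerSeries 2 G =
              PowerSeries.C (ϖ : ℚ_[2]) * iwasawaToPowerSeries 2 (kobayashiL 1 Lplus Lminus) ∧
            (∀ 𝔭 : PrimeSpectrum (IwasawaAlgebra 2), 𝔭.asIdeal.height = 1 →
              PowerSeries.C (2 : ℤ_[2]) ∉ 𝔭.asIdeal →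
              Literature.NumberTheory.EllipticCurves.Module.lengthAt (IwasawaAlgebra 2) Y.X 𝔭 ≤
                Literature.NumberTheory.EllipticCurves.Module.lengthAt (IwasawaAlgebra 2) (I.H ⧸ Z) 𝔭)) :
    SignedKatoDivisibilityUpToAtTwo := by
  intro W _ _ hcm hr hss ha κ γ hκ hγ hγ' _ f hf ϖ hϖ Lplus Lminus hPP D
  haveI : ContinuousSMul ℤ_[2] (W.tateModule 2) := TateModule.continuousSMul_padicInt
  obtain ⟨I, Y, P, loc, toX, δ, Z, G, hPX, hXY, hGZ, hιG, hES⟩ :=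
    hCK W hcm hr hss ha κ γ hκ hγ hγ' f hf ϖ hϖ Lplus Lminus hPP D
  have hY : Module.IsTorsion (IwasawaAlgebra 2) Y.X := hX0 W 2 κ γ hκ hγ Y
  obtain ⟨htf, hrank⟩ := h124.isTorsionFree_and_rank_le_one W 2 hκ hγ I
  haveI := htf
  obtain ⟨g, h, m, hg, hgh⟩ := exists_charGenerator_mul_eq_C_pow_mul_of_colemanSkeletonRat hγ I hrank Y D
    loc P.subtype P.injective_subtype toX δ hPX hXY hY Z hGZ
    (fun 𝔭 h1 hp𝔭 ↦ hES 𝔭 h1 (by simpa using hp𝔭)) hιG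
  refine ⟨g, h, m, hg, ?_⟩
  rw [hgh, map_mul, mul_assoc]
  norm_num

/-- **K3 (item 20308) from 19097's stubs (1′) `stub_katoPub` and (4) `stub_zeroColemanKato`, their v8
REGISTERED SIGNATURES VERBATIM** (line `signed_halves_two` on crux `SupersingularRankZeroAtTwo`): drop the
guarded last clause of (4) and apply `signedKatoDivisibilityUpToAtTwo_of_colemanKatoRatAtTwo`. TP2's K3 is
the RATIONAL first rung of 19097's stub (4) (memo CROSS-ROUTE-TP2-K3K4-v1 §2): 19097 additionally needs
`m = 0` (the guarded clause under `TwoAdicSurjective`, Kurihara–Otsuki p. 564) or `μ⁺ = 0` (stub (4′)),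
which TP2 replaces by transport from the CM partner. [cite: Kobayashi2003, Thm. 4.1 (p. 8) and §7 (pp. 12–13)]
[cite: Kato2004Asterisque, Thm. 12.4–12.5 (pp. 221–222)] [cite: KuriharaOtsuki2006, p. 564] -/
theorem signedKatoDivisibilityUpToAtTwo_of_zeroColemanKato
    (hKato : Kato2004.thm12_4 ∧ Kato2004_fineSelmerDual_isTorsion)
    (hCK : ∀ (W : WeierstrassCurve ℚ) [W.IsElliptic] [W.IsGloballyMinimal],
      ¬ W.HasCM → W.analyticRank = 0 → GoodSS W 2 → W.frobeniusTrace 2 = 0 →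
      ∀ (κ : ZpExtension ℚ 2) (γ : Field.absoluteGaloisGroup ℚ),
        κ.IsCyclotomic → κ.IsTopGenerator γ → IsCyclotomicVariable 2 γ →
        ∀ [NeZero (W.conductorNorm ℤ)] (f : CuspForm (Gamma0 (W.conductorNorm ℤ)) 2),
          IsNewformOf W f → ∀ (ϖ : ℚ), (ϖ : ℝ) * W.realPeriodRat = plusPeriod f →
        ∀ (Lplus Lminus : IwasawaAlgebra 2), IsPollackPair f 2 Lplus Lminus →
        ∀ (D : SignedSelmerDualData W κ γ 1) [ContinuousSMul ℤ_[2] (W.tateModule 2)],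
          ∃ (I : Kato2004.IwasawaH1Data W 2 κ γ) (Y : W.FineSelmerDualData κ γ)
            (P : Submodule (IwasawaAlgebra 2) (IwasawaAlgebra 2))
            (loc : I.H →ₗ[IwasawaAlgebra 2] P) (toX : P →ₗ[IwasawaAlgebra 2] D.X)
            (δ : D.X →ₗ[IwasawaAlgebra 2] Y.X) (Z : Submodule (IwasawaAlgebra 2) I.H)
            (G : IwasawaAlgebra 2),
            Function.Exact loc toX ∧ Function.Exact toX δ ∧
            G ∈ Submodule.map (P.subtype ∘ₗ loc) Z ∧
            iwasawaToPowerSeries 2 G =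
              PowerSeries.C (ϖ : ℚ_[2]) * iwasawaToPowerSeries 2 (kobayashiL 1 Lplus Lminus) ∧
            (∀ 𝔭 : PrimeSpectrum (IwasawaAlgebra 2), 𝔭.asIdeal.height = 1 →
              PowerSeries.C (2 : ℤ_[2]) ∉ 𝔭.asIdeal →
              Literature.NumberTheory.EllipticCurves.Module.lengthAt (IwasawaAlgebra 2) Y.X 𝔭 ≤
                Literature.NumberTheory.EllipticCurves.Module.lengthAt (IwasawaAlgebra 2) (I.H ⧸ Z) 𝔭) ∧
            (TwoAdicSurjective W →
              ∀ 𝔭 : PrimeSpectrum (IwasawaAlgebra 2), 𝔭.asIdeal.height = 1 →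
                PowerSeries.C (2 : ℤ_[2]) ∈ 𝔭.asIdeal →
                Literature.NumberTheory.EllipticCurves.Module.lengthAt (IwasawaAlgebra 2) Y.X 𝔭 ≤
                  Literature.NumberTheory.EllipticCurves.Module.lengthAt (IwasawaAlgebra 2) (I.H ⧸ Z) 𝔭)) :
    SignedKatoDivisibilityUpToAtTwo := by
  refine signedKatoDivisibilityUpToAtTwo_of_colemanKatoRatAtTwo hKato.1 hKato.2
    fun W _ _ hcm hr hss ha κ γ hκ hγ hγ' _ f hf ϖ hϖ Lplus Lminus hPP D _ => ?_
  obtain ⟨I, Y, P, loc, toX, δ, Z, G, hPX, hXY, hGZ, hιG, hES, -⟩ :=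
    hCK W hcm hr hss ha κ γ hκ hγ hγ' f hf ϖ hϖ Lplus Lminus hPP D
  exact ⟨I, Y, P, loc, toX, δ, Z, G, hPX, hXY, hGZ, hιG, hES⟩

end ThetaPartnerXRoute

end Summit.BirchSwinnertonDyer.BirchSwinnertonDyer.Theorems

end
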